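import Literature.RingTheory.NoetherNormalization.SeparableNoetherNormalization
import Literature.RingTheory.CohomologyAnnihilator.StrongGeneratorReduction
import Literature.RingTheory.CohomologyAnnihilator.NoetherNormalizationAnnihilator
import Literature.RingTheory.CohomologyAnnihilator.NoetherDifferentSeparable
import Literature.RingTheory.KrullDimension.AffineDimension
import HarnessLib

/-!
# An affine domain over a perfect field has `ca^{dim + 1} ≠ 0` (Iyengar–Takahashi, Thm. 3.6)

Topic: `Literature/RingTheory/CohomologyAnnihilator`.  [IyengarTakahashi2014, Theorem 3.6]:
"If `Λ` admits a separable noether normalization, then for `d = dim Z(Λ)` the ideal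
`ca^{d+1}(Λ)` of `Z(Λ)` is non-zero"; and (proof of Theorem 5.4, via Nagata 39.11) every affine
DOMAIN over a perfect field admits a separable noether normalisation.  We PROVE the combination

* `cohomologyAnnihilatorOfDegree_ne_bot_of_perfectField` — for a perfect field `K` and a
  finitely generated `K`-domain `B` of Krull dimension `e`, `cohomologyAnnihilatorOfDegree B (e+1)
  ≠ ⊥`,

which is VERBATIM the input `h₃₆` of `singEqVCa_essFiniteType_of_inputs`
(`StrongGeneratorReduction.lean`); after this file the named fact
`singEqVCa_essFiniteType` (Theorem 5.4, `V(ca R) = Sing R` for rings essentially of finite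
type over a field) rests only on its inputs `h₅₂` (Theorem 5.2) and `h_desc` (descent from
`k̄`) — recorded as `singEqVCa_essFiniteType_of_thm52_of_descent`.  Proof: separable Noether normalisation `K[y_1, …, y_d] ⊆ B`
(`exists_isIntegral_isSeparable_adjoin`), so `B` is module-finite over the polynomial ring
`P = K[Y_1, …, Y_d]` (injective `aeval y`), `Frac B` is separable over `K(y) = Frac P`, hence
`𝔑(B/P) ≠ 0` (`noetherDifferent_ne_bot_of_isSeparable`, Lemma 3.5) and `ca^{d+1}(B) ≠ 0`
(`cohomologyAnnihilatorOfDegree_ne_bot_of_mvPolynomial`, Theorem 3.6 / Prop. 3.4); finally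
`d = dim B` because `y` is a transcendence basis (`ringKrullDim_eq_card_of_isTranscendenceBasis`).

## References

* S. B. Iyengar, R. Takahashi, *Annihilation of cohomology and strong generation of module
  categories*, IMRN 2016; arXiv:1404.1476 — Theorem 3.6, Lemma 3.5, proof of Theorem 5.4.
  [`IyengarTakahashi2014`]
* C. Huneke, I. Swanson, *Integral Closure of Ideals, Rings, and Modules* (2006), Thm. 4.2.2.
  [HunekeSwanson2006]
-/

noncomputable section

namespace Literature.RingTheory.CohomologyAnnihilator

open Literature.RingTheory.NoetherNormalization
open scoped IntermediateField

universe u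

/-- **Input `h₃₆` of `singEqVCa_essFiniteType_of_inputs`, PROVED**: an affine domain `B` of Krull
dimension `e` over a PERFECT field `K` has `ca^{e+1}(B) ≠ 0` ([IyengarTakahashi2014, Thm. 3.6
with Lemma 3.5 and a separable noether normalisation, Nagata 39.11]). Proof: a separable Noether
normalisation `K[y_1, …, y_e] ⊆ B` (`exists_isIntegral_isSeparable_adjoin`: `B` finite over the
polynomial ring, `Frac B` separable over `K(y)`), so `𝔑(B/K[y]) ≠ 0`
(`noetherDifferent_ne_bot_of_isSeparable`) and `ca^{e+1}(B) ≠ 0`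
(`cohomologyAnnihilatorOfDegree_ne_bot_of_mvPolynomial`); `e = dim B` because `y` is a
transcendence basis. [cite: IyengarTakahashi2014, Thm. 3.6] -/
theorem cohomologyAnnihilatorOfDegree_ne_bot_of_perfectField (K : Type u) [Field K]
    [PerfectField K] (B : Type u) [CommRing B] [IsDomain B] [Algebra K B]
    (hB : Algebra.FiniteType K B) (e : ℕ) (he : ringKrullDim B = e) :
    cohomologyAnnihilatorOfDegree B (e + 1) ≠ ⊥ := by
  classical
  haveI := hB
  -- the fraction field and generators
  let L : Type u := FractionRing B
  have hinj : Function.Injective (algebraMap B L) := IsFractionRing.injective B L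
  obtain ⟨n, g, hg⟩ := Algebra.FiniteType.iff_quotient_mvPolynomial''.mp hB
  let x : Fin n → B := fun i => g (MvPolynomial.X i)
  have hgx : MvPolynomial.aeval x = g := MvPolynomial.algHom_ext fun i => MvPolynomial.aeval_X x i
  have htop : Algebra.adjoin K (Set.range x) = ⊤ := by
    rw [Algebra.adjoin_range_eq_range_aeval, hgx]
    exact (AlgHom.range_eq_top g).mpr hg
  -- separable Noether normalisation
  obtain ⟨d, y, -, hyind, hint, hsep⟩ := exists_isIntegral_isSeparable_adjoin K (L := L) hinj n x
  set P := MvPolynomial (Fin d) K with hP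
  let φ : P →ₐ[K] B := MvPolynomial.aeval y
  have hφinj : Function.Injective φ := (algebraicIndependent_iff_injective_aeval).mp hyind
  letI : Algebra P B := φ.toRingHom.toAlgebra
  have hφalg : ∀ q : P, algebraMap P B q = φ q := fun q => rfl
  haveI : IsScalarTower K P B := IsScalarTower.of_algebraMap_eq fun c => (φ.commutes c).symm
  -- `B` is integral, hence finite, over `P = K[y]`
  set Ay : Subalgebra K B := Algebra.adjoin K (Set.range y) with hAy
  have hφrange : ∀ q : P, φ q ∈ Ay := fun q => by
    rw [hAy, Algebra.adjoin_range_eq_range_aeval]; exact ⟨q, rfl⟩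
  let ψ : P →ₐ[K] Ay := φ.codRestrict Ay hφrange
  have hψsurj : Function.Surjective ψ := by
    rintro ⟨b, hb⟩
    rw [hAy, Algebra.adjoin_range_eq_range_aeval] at hb
    obtain ⟨q, rfl⟩ := hb
    exact ⟨q, rfl⟩
  letI : Algebra P Ay := ψ.toRingHom.toAlgebra
  haveI : IsScalarTower P Ay B := IsScalarTower.of_algebraMap_eq fun q => rfl
  haveI : Algebra.IsIntegral P Ay := Algebra.isIntegral_of_surjective hψsurj
  haveI : Algebra.IsIntegral Ay B := ⟨fun b =>
    isIntegral_of_mem_adjoin_of_forall_isIntegral (B' := Ay) (S := Set.range x)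
      (by rintro _ ⟨i, rfl⟩; exact hint i) (by rw [htop]; exact Algebra.mem_top)⟩
  haveI : Algebra.IsIntegral P B := Algebra.IsIntegral.trans Ay
  haveI : Algebra.FiniteType P B := Algebra.FiniteType.of_restrictScalars_finiteType K P B
  haveI : Module.Finite P B := Algebra.IsIntegral.finite
  haveI : FaithfulSMul P B := (faithfulSMul_iff_algebraMap_injective P B).mpr hφinj
  -- the fraction field `K₀ = K(y)` of `P` inside `L`
  let yL : Fin d → L := fun j => algebraMap B L (y j)
  have hyL : AlgebraicIndependent K yL := by
    rw [algebraicIndependent_iff_injective_aeval]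
    have : MvPolynomial.aeval yL = (IsScalarTower.toAlgHom K B L).comp (MvPolynomial.aeval y) :=
      (MvPolynomial.comp_aeval y (IsScalarTower.toAlgHom K B L)).symm
    rw [this]
    exact hinj.comp hφinj
  haveI : IsScalarTower P B L := inferInstance
  have hPL : ∀ q : P, algebraMap P L q = MvPolynomial.aeval yL q := fun q => by
    rw [IsScalarTower.algebraMap_apply P B L, hφalg]
    exact (DFunLike.congr_fun (MvPolynomial.comp_aeval y (IsScalarTower.toAlgHom K B L)) q)
  set K₀ : IntermediateField K L := IntermediateField.adjoin K (Set.range yL) with hK₀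
  have hmemK₀ : ∀ q : P, MvPolynomial.aeval yL q ∈ K₀ := fun q => by
    apply IntermediateField.algebra_adjoin_le_adjoin
    rw [Algebra.adjoin_range_eq_range_aeval]
    exact ⟨q, rfl⟩
  let toK₀ : P →ₐ[K] K₀ := (MvPolynomial.aeval yL).codRestrict K₀.toSubalgebra hmemK₀
  letI : Algebra P K₀ := toK₀.toRingHom.toAlgebra
  have hPK₀ : ∀ q : P, ((algebraMap P K₀ q : K₀) : L) = MvPolynomial.aeval yL q := fun q => rfl
  haveI : IsScalarTower P K₀ L := IsScalarTower.of_algebraMap_eq fun q => by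
    rw [hPL]; rfl
  let eqv : FractionRing P ≃ₐ[P] K₀ :=
    AlgEquiv.ofRingEquiv (f := hyL.aevalEquivField.toRingEquiv) fun q => by
      apply Subtype.ext
      change ((hyL.aevalEquivField (algebraMap P (FractionRing P) q) : K₀) : L) = _
      rw [AlgebraicIndependent.aevalEquivField_algebraMap_apply_coe, hPK₀]
  haveI : IsFractionRing P K₀ :=
    IsLocalization.isLocalization_of_algEquiv (nonZeroDivisors P) eqv
  -- `L = Frac B` is separable over `K₀`: it is generated by `B = K[x]`, each `x_i` separable
  haveI : Algebra.IsSeparable K₀ L := by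
    rw [← separableClosure.eq_top_iff, ← (IntermediateField.restrictScalars_injective K).eq_iff,
      IntermediateField.restrictScalars_top, eq_top_iff]
    intro ℓ _
    obtain ⟨a, b, -, rfl⟩ := IsFractionRing.div_surjective (A := B) ℓ
    set S : Subalgebra K B :=
      ((separableClosure K₀ L).restrictScalars K).toSubalgebra.comap (IsScalarTower.toAlgHom K B L)
      with hS
    have hS' : ∀ c : B, algebraMap B L c ∈ (separableClosure K₀ L).restrictScalars K := by
      have hle : Algebra.adjoin K (Set.range x) ≤ S := by
        refine Algebra.adjoin_le ?_
        rintro _ ⟨i, rfl⟩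
        change algebraMap B L (x i) ∈ (separableClosure K₀ L).restrictScalars K
        exact (mem_separableClosure_iff.mpr (hsep i))
      intro c
      have hc : c ∈ S := hle (by rw [htop]; exact Algebra.mem_top)
      exact hc
    exact div_mem (hS' a) (hS' b)
  -- conclude
  have hN : noetherDifferent P B ≠ ⊥ := noetherDifferent_ne_bot_of_isSeparable P (B := B) K₀ L
  have hca := cohomologyAnnihilatorOfDegree_ne_bot_of_mvPolynomial K d hφinj hN
  -- `d = e`
  have hdim : ringKrullDim B = d := by
    have htb : IsTranscendenceBasis K y := by
      rw [hyind.isTranscendenceBasis_iff_isAlgebraic]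
      haveI : Algebra.IsIntegral Ay B := inferInstance
      exact Algebra.IsIntegral.isAlgebraic
    rw [Literature.RingTheory.KrullDimension.ringKrullDim_eq_card_of_isTranscendenceBasis K B htb,
      Fintype.card_fin]
  have hde : d = e := by
    rw [he] at hdim
    exact_mod_cast hdim.symm
  rw [← hde]
  exact hca

open CategoryTheory in
open scoped TensorProduct in
/-- **Theorem 5.4 of [IyengarTakahashi2014] from its two remaining printed inputs.** With `h₃₆`
discharged (`cohomologyAnnihilatorOfDegree_ne_bot_of_perfectField`), the named fact
`singEqVCa_essFiniteType` (`V(ca R) = V(ca^{2d+1} R) = Sing R` for localisations of finitely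
generated algebras of Krull dimension `d` over a field) follows from `h₅₂` = Theorem 5.2 (a
noetherian ring of dimension `d` all of whose prime quotients have `caˢ ≠ 0`, `s ≤ dim + 1`,
has a strong generator `Ω^d(mod R) ⊆ |G|ₙ`) and `h_desc` = the descent of a strong generator
from `k̄ ⊗_k A` to `A` (proof of Theorem 5.4, after Keller–Van den Bergh), stated verbatim as in
`singEqVCa_essFiniteType_of_inputs`. [cite: IyengarTakahashi2014, Thm. 5.4 (proof)] -/
theorem singEqVCa_essFiniteType_of_thm52_of_descent
    (h₅₂ : ∀ (R : Type u) [CommRing R] [IsNoetherianRing R] (d : ℕ), ringKrullDim R = d →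
      (∀ (𝔭 : Ideal R) [𝔭.IsPrime], ∃ s : ℕ, (s : WithBot ℕ∞) ≤ ringKrullDim (R ⧸ 𝔭) + 1 ∧
        cohomologyAnnihilatorOfDegree (R ⧸ 𝔭) s ≠ ⊥) →
      ∃ G : ModuleCat.{u} R, Module.Finite R G ∧ ∃ n : ℕ, ∀ M : ModuleCat.{u} R,
        Module.Finite R M → ∃ K : ModuleCat.{u} R, IsSyzygy d M K ∧ InTower G n K)
    (h_desc : ∀ (k : Type u) [Field k] (K : Type u) [Field K] [Algebra k K] [IsAlgClosed K]
      [Algebra.IsAlgebraic k K] (A : Type u) [CommRing A] [Algebra k A], Algebra.FiniteType k A →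
      ∀ d : ℕ, (∃ G : ModuleCat.{u} (K ⊗[k] A), Module.Finite (K ⊗[k] A) G ∧ ∃ n : ℕ,
          ∀ M : ModuleCat.{u} (K ⊗[k] A), Module.Finite (K ⊗[k] A) M →
            ∃ K' : ModuleCat.{u} (K ⊗[k] A), IsSyzygy d M K' ∧ InTower G n K') →
        ∃ G : ModuleCat.{u} A, Module.Finite A G ∧ ∃ n : ℕ, ∀ M : ModuleCat.{u} A,
          Module.Finite A M → ∃ K' : ModuleCat.{u} A, IsSyzygy d M K' ∧ InTower G n K') :
    singEqVCa_essFiniteType.{u} :=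
  singEqVCa_essFiniteType_of_inputs
    (fun K _ _ B _ _ _ hB e he => cohomologyAnnihilatorOfDegree_ne_bot_of_perfectField K B hB e he)
    h₅₂ h_desc

end Literature.RingTheory.CohomologyAnnihilator

end
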